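import Literature.Probability.Percolation.IntPairCross
import HarnessLib

/-!
# The cross-frame inner pair step: two clean routes exiting on different inner sides (contraction + Menger) (twin of `TrapPairCrossClean.lean`)

Topic `Literature/Probability/Percolation`; family `crit-perc` / near-critical percolation on `𝕋`.
A brick of the INNER half of the near-critical arm-separation theorem for four arms in the ADJACENT
colour arrangement (P. Nolin, EJP 13 (2008), Thm. 11, `j = 4`, `σ = BBWW` [arXiv 0711.4948:
Thm. 10], §4.4 Lemma 15, internal extremities). Word-for-word twin of `TrapPairCrossClean.lean`:
`IntPairDataB.FFB`, `IntCrossData.FF𝔉₁/₂`, `B𝔅`, `ExitRef`, the contracted graph `cG`, `hcut_cG`,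
`finish`, `exists_two_clean_routes`, `mem_B𝔅`.

Everything here is proved; no named facts are introduced.

## References

* P. Nolin, Near-critical percolation in two dimensions, *Electron. J. Probab.* 13 (2008), §4.4,
  proof of Lemma 15, internal extremities (arXiv 0711.4948: Lemma 14) [Nolin2008].
* R. Diestel, *Graph Theory*, 5th ed. (2017), Thm. 3.3.1 (Menger) and §1.7 (contraction) [Diestel2017].
-/

noncomputable section

open Set

namespace Literature.Probability.Percolation

open LatticeModels HalfAnnulus Literature.Combinatorics.SimpleGraph

open IntPairData (term_isCrossing term_eq)

/-! ### All fence sites of one structure -/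

namespace IntPairDataB

variable {m N k₀ K T T' R₀ : ℕ} {ω : SiteConfig (Site 2)}

/-- **All fence sites of the structure**: the connections of the fences of the terms from below
and from above. [folklore] -/
def FFB (D : IntPairDataB m N k₀ K T T' R₀ ω) : Set (Site 2) :=
  {v | ∃ (u : ℕ) (c : Finset (Site 2)) (z : Site 2) (hu : (intDom m).lowestSeq ω u = some (c, z)), v ∈ (D.fence hu).F} ∪
    {v | ∃ (u : ℕ) (d : Finset (Site 2)) (z : Site 2) (hu : (intDom m).flip.lowestSeq ω u = some (d, z)), v ∈ (D.fenceUp hu).F}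

/-- Fence sites are admissible. [folklore] -/
theorem FFB_subset_AsetB (D : IntPairDataB m N k₀ K T T' R₀ ω) : D.FFB ⊆ D.AsetB := by
  rintro v (⟨u, c, z, hu, hv⟩ | ⟨u, d, z, hu, hv⟩)
  · exact D.Aset_subset_AsetB (D.fence_subset_Aset hu hv)
  · exact D.fenceUp_subset_AsetB hu hv

/-- The targets are fence sites. [folklore] -/
theorem TsetB_subset_FFB (D : IntPairDataB m N k₀ K T T' R₀ ω) : D.TsetB ⊆ D.FFB := by
  rintro v (⟨u, c, z, hu, rfl⟩ | ⟨u, d, z, hu, rfl⟩)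
  · exact Or.inl ⟨u, c, z, hu, (D.fence hu).m'_mem⟩
  · exact Or.inr ⟨u, d, z, hu, (D.fenceUp hu).path.right_mem⟩

/-- Fence sites avoid the arms. [folklore] -/
theorem not_mem_FFB_of_mem_armSet (D : IntPairDataB m N k₀ K T T' R₀ ω) {v : Site 2} (hv : v ∈ D.armSet) : v ∉ D.FFB := by
  rintro (⟨u, c, z, hu, hvF⟩ | ⟨u, d, z, hu, hvF⟩)
  · exact D.fence_disjoint_arm hu hvF hv
  · exact D.fenceUp_disjoint_arm hu hvF hv

end IntPairDataB

namespace IntCrossData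

variable {m N k₀ K T₁ T₁' T₂ T₂' R₀ : ℕ} {χ₁ χ₂ : SiteConfig (Site 2)} (X : IntCrossData m N k₀ K T₁ T₁' T₂ T₂' R₀ χ₁ χ₂)

/-! ### Actual fence sites, non-fence sites, exits -/

/-- The actual fence sites of `D₁`. [folklore] -/
def FF𝔉₁ : Set (Site 2) := X.φ₁ '' X.D₁.FFB

/-- The actual fence sites of `D₂`. [folklore] -/
def FF𝔉₂ : Set (Site 2) := X.φ₂ '' X.D₂.FFB

/-- All actual fence sites. [folklore] -/
def FF𝔉 : Set (Site 2) := X.FF𝔉₁ ∪ X.FF𝔉₂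

/-- **The non-fence admissible sites** (arms and terms of both structures). [folklore] -/
def B𝔅 : Set (Site 2) := X.Aset𝔄 \ X.FF𝔉

/-- The two families of actual fence sites are disjoint. [folklore] -/
theorem FF_disjoint (X : IntCrossData m N k₀ K T₁ T₁' T₂ T₂' R₀ χ₁ χ₂) {v : Site 2} (h₁ : v ∈ X.FF𝔉₁) (h₂ : v ∈ X.FF𝔉₂) : False := by
  obtain ⟨x, hx, rfl⟩ := h₁
  obtain ⟨y, hy, hxy⟩ := h₂
  exact X.fence_far x y hx hy hxy.symm

/-- Fence sites are admissible. [folklore] -/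
theorem FF_subset_Aset𝔄 (X : IntCrossData m N k₀ K T₁ T₁' T₂ T₂' R₀ χ₁ χ₂) : X.FF𝔉 ⊆ X.Aset𝔄 := by
  rintro v (⟨x, hx, rfl⟩ | ⟨x, hx, rfl⟩)
  · exact Or.inl ⟨x, X.D₁.FFB_subset_AsetB hx, rfl⟩
  · exact Or.inr ⟨x, X.D₂.FFB_subset_AsetB hx, rfl⟩

/-- The targets are fence sites. [folklore] -/
theorem Tset𝔗_subset_FF (X : IntCrossData m N k₀ K T₁ T₁' T₂ T₂' R₀ χ₁ χ₂) : X.Tset𝔗 ⊆ X.FF𝔉 := by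
  rintro v (⟨x, hx, rfl⟩ | ⟨x, hx, rfl⟩)
  · exact Or.inl ⟨x, X.D₁.TsetB_subset_FFB hx, rfl⟩
  · exact Or.inr ⟨x, X.D₂.TsetB_subset_FFB hx, rfl⟩

/-- The starts are not fence sites. [folklore] -/
theorem start_not_mem_FF (X : IntCrossData m N k₀ K T₁ T₁' T₂ T₂' R₀ χ₁ χ₂) {s : Site 2} (hs : s ∈ X.Src) : s ∉ X.FF𝔉 := by
  have key : ∀ i : Fin 2, X.φ₁ (X.D₁.b i) ∉ X.FF𝔉 := by
    intro i
    rintro (⟨x, hx, hxe⟩ | ⟨x, hx, hxe⟩)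
    · rw [X.φ₁.injective hxe] at hx
      exact X.D₁.not_mem_FFB_of_mem_armSet (X.D₁.mem_armSet (X.D₁.A i).start_mem_support) hx
    · have harm : X.D₁.b i ∈ X.D₁.armSet := X.D₁.mem_armSet (X.D₁.A i).start_mem_support
      have h2 := (X.armSet_corr).1 harm
      rw [← hxe, RelIso.symm_apply_apply] at h2
      exact X.D₂.not_mem_FFB_of_mem_armSet h2 hx
  rcases hs with h | h
  · rw [h]; exact key 0
  · rw [Set.mem_singleton_iff.1 h]; exact key 1

/-- The starts are non-fence admissible sites. [folklore] -/
theorem start_mem_B𝔅 (X : IntCrossData m N k₀ K T₁ T₁' T₂ T₂' R₀ χ₁ χ₂) {s : Site 2} (hs : s ∈ X.Src) : s ∈ X.B𝔅 := by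
  refine ⟨?_, X.start_not_mem_FF hs⟩
  rcases hs with h | h
  · rw [h]; exact Or.inl ⟨_, X.D₁.Aset_subset_AsetB (X.D₁.armSet_subset_Aset (X.D₁.mem_armSet (X.D₁.A 0).start_mem_support)), rfl⟩
  · rw [Set.mem_singleton_iff.1 h]
    exact Or.inl ⟨_, X.D₁.Aset_subset_AsetB (X.D₁.armSet_subset_Aset (X.D₁.mem_armSet (X.D₁.A 1).start_mem_support)), rfl⟩

/-- **An exit of the cross step**: a fence of one of the four families (structure `D₁`/`D₂`, term
from below/from above). [folklore] -/
inductive ExitRef (X : IntCrossData m N k₀ K T₁ T₁' T₂ T₂' R₀ χ₁ χ₂) : Type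
  | below₁ (u : ℕ) (c : Finset (Site 2)) (z : Site 2) (hu : (intDom m).lowestSeq χ₁ u = some (c, z)) : ExitRef X
  | up₁ (u : ℕ) (d : Finset (Site 2)) (z : Site 2) (hu : (intDom m).flip.lowestSeq χ₁ u = some (d, z)) : ExitRef X
  | below₂ (u : ℕ) (c : Finset (Site 2)) (z : Site 2) (hu : (intDom m).lowestSeq χ₂ u = some (c, z)) : ExitRef X
  | up₂ (u : ℕ) (d : Finset (Site 2)) (z : Site 2) (hu : (intDom m).flip.lowestSeq χ₂ u = some (d, z)) : ExitRef X

variable {X} in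
/-- The structure (side) of an exit. [folklore] -/
def ExitRef.side : X.ExitRef → Fin 2
  | .below₁ _ _ _ _ => 0
  | .up₁ _ _ _ _ => 0
  | .below₂ _ _ _ _ => 1
  | .up₂ _ _ _ _ => 1

variable {X} in
/-- The actual connection of the fence of an exit. [folklore] -/
def ExitRef.F𝔄 : X.ExitRef → Set (Site 2)
  | .below₁ _ _ _ hu => X.φ₁ '' (X.D₁.fence hu).F
  | .up₁ _ _ _ hu => X.φ₁ '' (X.D₁.fenceUp hu).F
  | .below₂ _ _ _ hu => X.φ₂ '' (X.D₂.fence hu).F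
  | .up₂ _ _ _ hu => X.φ₂ '' (X.D₂.fenceUp hu).F

variable {X} in
/-- The actual fence site of an exit. [folklore] -/
def ExitRef.m𝔄 : X.ExitRef → Site 2
  | .below₁ _ _ _ hu => X.φ₁ (X.D₁.fence hu).m'
  | .up₁ _ _ _ hu => X.φ₁ (X.D₁.fenceUp hu).m'
  | .below₂ _ _ _ hu => X.φ₂ (X.D₂.fence hu).m'
  | .up₂ _ _ _ hu => X.φ₂ (X.D₂.fenceUp hu).m'

/-- The connection of an exit of the side `0` consists of fence sites of `D₁`, of the side `1` of `D₂`. [folklore] -/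
theorem ExitRef.F𝔄_subset {X : IntCrossData m N k₀ K T₁ T₁' T₂ T₂' R₀ χ₁ χ₂} (er : X.ExitRef) : (er.side = 0 → er.F𝔄 ⊆ X.FF𝔉₁) ∧ (er.side = 1 → er.F𝔄 ⊆ X.FF𝔉₂) := by
  cases er with
  | below₁ u c z hu => exact ⟨fun _ => Set.image_mono fun v hv => Or.inl ⟨u, c, z, hu, hv⟩, fun h => absurd h (by simp [ExitRef.side])⟩
  | up₁ u d z hu => exact ⟨fun _ => Set.image_mono fun v hv => Or.inr ⟨u, d, z, hu, hv⟩, fun h => absurd h (by simp [ExitRef.side])⟩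
  | below₂ u c z hu => exact ⟨fun h => absurd h (by simp [ExitRef.side]), fun _ => Set.image_mono fun v hv => Or.inl ⟨u, c, z, hu, hv⟩⟩
  | up₂ u d z hu => exact ⟨fun h => absurd h (by simp [ExitRef.side]), fun _ => Set.image_mono fun v hv => Or.inr ⟨u, d, z, hu, hv⟩⟩

/-- The connection of an exit consists of fence sites. [folklore] -/
theorem ExitRef.F𝔄_subset_FF {X : IntCrossData m N k₀ K T₁ T₁' T₂ T₂' R₀ χ₁ χ₂} (er : X.ExitRef) : er.F𝔄 ⊆ X.FF𝔉 := by
  obtain ⟨h0, h1⟩ := er.F𝔄_subset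
  have : er.side = 0 ∨ er.side = 1 := by
    rcases er with _ | _ | _ | _ <;> simp [ExitRef.side]
  rcases this with h | h
  · exact (h0 h).trans Set.subset_union_left
  · exact (h1 h).trans Set.subset_union_right

/-- Connections of exits on different sides are disjoint. [folklore] -/
theorem ExitRef.F𝔄_disjoint {X : IntCrossData m N k₀ K T₁ T₁' T₂ T₂' R₀ χ₁ χ₂} {er e' : X.ExitRef} (h : er.side ≠ e'.side) : Disjoint er.F𝔄 e'.F𝔄 := by
  rw [Set.disjoint_left]
  intro v hv hv'
  obtain ⟨h0, h1⟩ := er.F𝔄_subset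
  obtain ⟨h0', h1'⟩ := e'.F𝔄_subset
  have hs : ∀ f : X.ExitRef, f.side = 0 ∨ f.side = 1 := fun f => by
    rcases f with _ | _ | _ | _ <;> simp [ExitRef.side]
  rcases hs er with he | he <;> rcases hs e' with he' | he'
  · exact h (he.trans he'.symm)
  · exact X.FF_disjoint (h0 he hv) (h1' he' hv')
  · exact X.FF_disjoint (h0' he' hv') (h1 he hv)
  · exact h (he.trans he'.symm)

/-! ### The contracted graph -/

/-- **Adjacency to a contracted structure**: `y` is the representative `r₁` (`r₂`) and `x` is
`𝕋`-adjacent to an actual fence site of `D₁` (`D₂`). [folklore] -/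
def AdjF (r₁ r₂ x y : Site 2) : Prop :=
  (y = r₁ ∧ ∃ f ∈ X.FF𝔉₁, triGraph.Adj x f) ∨ (y = r₂ ∧ ∃ f ∈ X.FF𝔉₂, triGraph.Adj x f)

/-- **The contracted graph**: `𝕋`-adjacency between non-fence sites, and a non-fence site joined to
the representative of each structure one of whose fence sites it is adjacent to. [cite: Diestel2017, §1.7] -/
def cG (r₁ r₂ : Site 2) : SimpleGraph (Site 2) where
  Adj x y := x ≠ y ∧ ((x ∉ X.FF𝔉 ∧ y ∉ X.FF𝔉 ∧ triGraph.Adj x y) ∨ (x ∉ X.FF𝔉 ∧ X.AdjF r₁ r₂ x y) ∨ (y ∉ X.FF𝔉 ∧ X.AdjF r₁ r₂ y x))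
  symm := ⟨fun _ _ ⟨hne, h⟩ => ⟨hne.symm, by
    rcases h with h | h | h
    · exact Or.inl ⟨h.2.1, h.1, h.2.2.symm⟩
    · exact Or.inr (Or.inr h)
    · exact Or.inr (Or.inl h)⟩⟩
  loopless := ⟨fun _ h => h.1 rfl⟩

/-- The admissible vertices of the contracted graph: non-fence sites and the two representatives. [folklore] -/
def cA (r₁ r₂ : Site 2) : Set (Site 2) := X.B𝔅 ∪ {r₁, r₂}

variable {X}

/-- A `𝕋`-path through non-fence sites is a path of the contracted graph. [folklore] -/
theorem pathIn_cG_of_pathIn (X : IntCrossData m N k₀ K T₁ T₁' T₂ T₂' R₀ χ₁ χ₂) {r₁ r₂ : Site 2} {Y : Set (Site 2)} {x y : Site 2}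
    (h : PathIn triGraph Y x y) (hY : ∀ v ∈ Y, v ∉ X.FF𝔉) : PathIn (X.cG r₁ r₂) Y x y := by
  obtain ⟨hx, h⟩ := h
  refine ⟨hx, ?_⟩
  induction h with
  | refl => exact Relation.ReflTransGen.refl
  | @tail b c hb hbc ih =>
    have hbY : b ∈ Y := (show PathIn triGraph Y x b from ⟨hx, hb⟩).right_mem
    exact ih.tail ⟨⟨hbc.1.ne, Or.inl ⟨hY b hbY, hY c hbc.2, hbc.1⟩⟩, hbc.2⟩

/-- A path of the contracted graph through non-fence sites is a `𝕋`-path (representatives in `FF`). [folklore] -/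
theorem pathIn_of_pathIn_cG (X : IntCrossData m N k₀ K T₁ T₁' T₂ T₂' R₀ χ₁ χ₂) {r₁ r₂ : Site 2} (hr₁ : r₁ ∈ X.FF𝔉) (hr₂ : r₂ ∈ X.FF𝔉) {Y : Set (Site 2)} {x y : Site 2}
    (h : PathIn (X.cG r₁ r₂) Y x y) (hY : ∀ v ∈ Y, v ∉ X.FF𝔉) : PathIn triGraph Y x y := by
  obtain ⟨hx, h⟩ := h
  refine ⟨hx, ?_⟩
  have hAF : ∀ {a b : Site 2}, X.AdjF r₁ r₂ a b → b ∈ X.FF𝔉 := by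
    rintro a b (⟨rfl, -⟩ | ⟨rfl, -⟩)
    exacts [hr₁, hr₂]
  induction h with
  | refl => exact Relation.ReflTransGen.refl
  | @tail b c hb hbc ih =>
    have hbY : b ∈ Y := (show PathIn (X.cG r₁ r₂) Y x b from ⟨hx, hb⟩).right_mem
    have hadj : triGraph.Adj b c := by
      rcases hbc.1.2 with h | h | h
      · exact h.2.2
      · exact absurd (hAF h.2) (hY c hbc.2)
      · exact absurd (hAF h.2) (hY b hbY)
    exact ih.tail ⟨hadj, hbc.2⟩

/-- **From an admissible `𝕋`-route reaching a fence site to a contracted route** avoiding `z`: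
truncate at the first fence site and enter the representative of its structure. The representative
entered must differ from `z`: either `rₛ ≠ z`, or the route avoids the fence sites of that structure. [cite: Diestel2017, §1.7] -/
theorem cRoute_of_route (X : IntCrossData m N k₀ K T₁ T₁' T₂ T₂' R₀ χ₁ χ₂) {r₁ r₂ : Site 2} (hr₁ : r₁ ∈ X.FF𝔉₁) (hr₂ : r₂ ∈ X.FF𝔉₂) {z s t : Site 2} {Y : Set (Site 2)}
    (hz₁ : r₁ ≠ z ∨ ∀ v ∈ Y, v ∉ X.FF𝔉₁) (hz₂ : r₂ ≠ z ∨ ∀ v ∈ Y, v ∉ X.FF𝔉₂)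
    (hs : s ∉ X.FF𝔉) (ht : t ∈ X.FF𝔉) (hYA : Y ⊆ X.Aset𝔄 \ {z}) (h : PathIn triGraph Y s t) :
    ∃ t', (t' = r₁ ∨ t' = r₂) ∧ PathIn (X.cG r₁ r₂) (X.cA r₁ r₂ \ {z}) s t' := by
  have hsR : s ∈ (X.FF𝔉)ᶜ := hs
  have htR : t ∉ (X.FF𝔉)ᶜ := fun h' => h' ht
  obtain ⟨a', b, ha', hbR, hbY, hab, hP⟩ := h.exit (R := (X.FF𝔉)ᶜ) hsR htR
  have hbF : b ∈ X.FF𝔉 := not_not.1 hbR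
  have hsub : (X.FF𝔉)ᶜ ∩ Y ⊆ X.cA r₁ r₂ \ {z} := fun v hv => ⟨Or.inl ⟨(hYA hv.2).1, hv.1⟩, (hYA hv.2).2⟩
  have hP' : PathIn (X.cG r₁ r₂) (X.cA r₁ r₂ \ {z}) s a' := (X.pathIn_cG_of_pathIn hP fun v hv => hv.1).mono hsub
  have ha'F : a' ∉ X.FF𝔉 := ha'
  have hr₁F : r₁ ∈ X.FF𝔉 := Or.inl hr₁
  have hr₂F : r₂ ∈ X.FF𝔉 := Or.inr hr₂
  rcases hbF with hb | hb
  · have hne : r₁ ≠ z := hz₁.resolve_right fun hno => hno b hbY hb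
    have hm : r₁ ∈ X.cA r₁ r₂ \ {z} := ⟨Or.inr (Or.inl rfl), fun e => hne (Set.mem_singleton_iff.1 e)⟩
    have hadj : (X.cG r₁ r₂).Adj a' r₁ :=
      ⟨fun e => ha'F (by rw [e]; exact hr₁F), Or.inr (Or.inl ⟨ha'F, Or.inl ⟨rfl, b, hb, hab⟩⟩)⟩
    exact ⟨r₁, Or.inl rfl, hP'.tail hadj hm⟩
  · have hne : r₂ ≠ z := hz₂.resolve_right fun hno => hno b hbY hb
    have hm : r₂ ∈ X.cA r₁ r₂ \ {z} := ⟨Or.inr (Or.inr rfl), fun e => hne (Set.mem_singleton_iff.1 e)⟩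
    have hadj : (X.cG r₁ r₂).Adj a' r₂ :=
      ⟨fun e => ha'F (by rw [e]; exact hr₂F), Or.inr (Or.inl ⟨ha'F, Or.inr ⟨rfl, b, hb, hab⟩⟩)⟩
    exact ⟨r₂, Or.inr rfl, hP'.tail hadj hm⟩

/-! ### No admissible vertex of the contracted graph is a cut -/

/-- **No admissible vertex of the contracted graph is a cut**, under the two AVOIDANCE HYPOTHESES:
some start of `D₁` (`D₂`) is joined, inside the enlarged admissible set of `D₁` (`D₂`) and off every
actual fence site of `D₂` (`D₁`), to a fence site of `D₁` (`D₂`) — discharged from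
`IntPairDataB.route_c_avoid/route_d_avoid` (`TrapPairAvoid.lean`) and the position of the fences. [cite: Nolin2008, §4.4 Lemma 15 (proof) (arXiv 0711.4948: Lemma 14, last paragraph)] [cite: Diestel2017, §1.7] -/
theorem hcut_cG (X : IntCrossData m N k₀ K T₁ T₁' T₂ T₂' R₀ χ₁ χ₂) {r₁ r₂ : Site 2} (hr₁ : r₁ ∈ X.FF𝔉₁) (hr₂ : r₂ ∈ X.FF𝔉₂)
    (hav₁ : (∃ (i : Fin 2) (S : Set (Site 2)) (t : Site 2), t ∈ X.D₁.FFB ∧ PathIn triGraph S (X.D₁.b i) t ∧ S ⊆ X.D₁.AsetB ∧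
      ∀ x ∈ S, X.φ₁ x ∉ X.FF𝔉₂))
    (hav₂ : (∃ (i : Fin 2) (S : Set (Site 2)) (t : Site 2), t ∈ X.D₂.FFB ∧ PathIn triGraph S (X.D₂.b i) t ∧ S ⊆ X.D₂.AsetB ∧
      ∀ x ∈ S, X.φ₂ x ∉ X.FF𝔉₁)) :
    ∀ zz ∈ X.cA r₁ r₂, ∃ (s t : Site 2) (q : (X.cG r₁ r₂).Walk s t), s ∈ X.Src ∧ t ∈ ({r₁, r₂} : Set (Site 2)) ∧
      (∀ y ∈ q.support, y ∈ X.cA r₁ r₂) ∧ zz ∉ q.support := by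
  classical
  have hr₁F : r₁ ∈ X.FF𝔉 := Or.inl hr₁
  have hr₂F : r₂ ∈ X.FF𝔉 := Or.inr hr₂
  have hne : r₁ ≠ r₂ := fun e => X.FF_disjoint hr₁ (e ▸ hr₂)
  -- packaging a contracted route
  have pack : ∀ {s t zz : Site 2}, s ∈ X.Src → (t = r₁ ∨ t = r₂) → PathIn (X.cG r₁ r₂) (X.cA r₁ r₂ \ {zz}) s t →
      ∃ (s' t' : Site 2) (q : (X.cG r₁ r₂).Walk s' t'), s' ∈ X.Src ∧ t' ∈ ({r₁, r₂} : Set (Site 2)) ∧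
        (∀ y ∈ q.support, y ∈ X.cA r₁ r₂) ∧ zz ∉ q.support := by
    intro s t zz hs ht hP
    obtain ⟨w, hw⟩ := hP.exists_walk
    refine ⟨s, t, w, hs, ?_, fun y hy => (hw y hy).1, fun hy => (hw zz hy).2 (Set.mem_singleton zz)⟩
    rcases ht with rfl | rfl
    exacts [Or.inl rfl, Or.inr rfl]
  rintro zz (hzz | hzz)
  · -- a non-fence site: Menger's hypothesis of the `𝕋`-setting, truncated at the first fence site
    obtain ⟨s, t, q, hs, ht, hqA, hzq⟩ := X.menger_hcut𝔄 zz hzz.1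
    have hP : PathIn triGraph {v | v ∈ q.support} s t := PathIn.of_walk q fun x hx => hx
    have hYA : {v | v ∈ q.support} ⊆ X.Aset𝔄 \ {zz} := fun v hv =>
      ⟨hqA v hv, fun e => hzq (by rw [← Set.mem_singleton_iff.1 e]; exact hv)⟩
    obtain ⟨t', ht', hP'⟩ := X.cRoute_of_route (z := zz) hr₁ hr₂ (Or.inl fun e => hzz.2 (e ▸ hr₁F))
      (Or.inl fun e => hzz.2 (e ▸ hr₂F)) (X.start_not_mem_FF hs) (X.Tset𝔗_subset_FF ht) hYA hP
    exact pack hs ht' hP'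
  · -- a representative: the avoiding route of the other structure
    rcases hzz with hz | hz
    · obtain ⟨i, S, t, ht, hP, hSA, hSav⟩ := hav₂
      have hYA : X.φ₂ '' S ⊆ X.Aset𝔄 \ {zz} := by
        rintro v ⟨x, hx, rfl⟩
        exact ⟨Or.inr ⟨x, hSA hx, rfl⟩, fun e => hSav x hx (by rw [Set.mem_singleton_iff.1 e, hz]; exact hr₁)⟩
      have hs := X.start_mem₂ i
      obtain ⟨t', ht', hQ⟩ := X.cRoute_of_route (z := zz) hr₁ hr₂ (Or.inr (by rintro v ⟨x, hx, rfl⟩; exact hSav x hx))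
        (Or.inl fun e => hne (e.trans hz).symm) (X.start_not_mem_FF hs) (Or.inr ⟨t, ht, rfl⟩) hYA (pathIn_map_iso X.φ₂ hP)
      exact pack hs ht' hQ
    · rw [Set.mem_singleton_iff] at hz
      obtain ⟨i, S, t, ht, hP, hSA, hSav⟩ := hav₁
      have hYA : X.φ₁ '' S ⊆ X.Aset𝔄 \ {zz} := by
        rintro v ⟨x, hx, rfl⟩
        exact ⟨Or.inl ⟨x, hSA hx, rfl⟩, fun e => hSav x hx (by rw [Set.mem_singleton_iff.1 e, hz]; exact hr₂)⟩
      have hs := X.start_mem₁ i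
      obtain ⟨t', ht', hQ⟩ := X.cRoute_of_route (z := zz) hr₁ hr₂ (Or.inl fun e => hne (hz ▸ e))
        (Or.inr (by rintro v ⟨x, hx, rfl⟩; exact hSav x hx)) (X.start_not_mem_FF hs) (Or.inl ⟨t, ht, rfl⟩) hYA
        (pathIn_map_iso X.φ₁ hP)
      exact pack hs ht' hQ

/-! ### Two clean routes -/

/-- **Finishing a contracted route** whose only representative is its end `t`: the last edge before
`t` is an adjacency to an actual fence site of the structure of `t`; continue inside the connection
of that fence to its fence site. [cite: Diestel2017, §1.7] -/
theorem finish (X : IntCrossData m N k₀ K T₁ T₁' T₂ T₂' R₀ χ₁ χ₂) {r₁ r₂ : Site 2} (hr₁ : r₁ ∈ X.FF𝔉₁) (hr₂ : r₂ ∈ X.FF𝔉₂) {s t : Site 2} (p : (X.cG r₁ r₂).Walk s t)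
    (hs : s ∈ X.B𝔅) (ht : t ∈ ({r₁, r₂} : Set (Site 2))) (hpA : ∀ y ∈ p.support, y ∈ X.cA r₁ r₂)
    (honly : ∀ y ∈ p.support, y ∈ ({r₁, r₂} : Set (Site 2)) → y = t) :
    ∃ (e : X.ExitRef) (S : Set (Site 2)), (e.side = 0 ↔ t = r₁) ∧ PathIn triGraph S s e.m𝔄 ∧ e.m𝔄 ∈ e.F𝔄 ∧
      S ⊆ {v | v ∈ p.support ∧ v ∈ X.B𝔅} ∪ e.F𝔄 := by
  classical
  have hr₁F : r₁ ∈ X.FF𝔉 := Or.inl hr₁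
  have hr₂F : r₂ ∈ X.FF𝔉 := Or.inr hr₂
  have hne : r₁ ≠ r₂ := fun e => X.FF_disjoint hr₁ (e ▸ hr₂)
  have hRF : ∀ y ∈ ({r₁, r₂} : Set (Site 2)), y ∈ X.FF𝔉 := by
    rintro y (h | h)
    · exact h ▸ hr₁F
    · exact (Set.mem_singleton_iff.1 h) ▸ hr₂F
  have hP : PathIn (X.cG r₁ r₂) {v | v ∈ p.support} s t := PathIn.of_walk p fun x hx => hx
  have hsR : s ∈ ({r₁, r₂} : Set (Site 2))ᶜ := fun h => hs.2 (hRF s h)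
  have htR : t ∉ ({r₁, r₂} : Set (Site 2))ᶜ := fun h => h ht
  obtain ⟨a', b, -, hbR, hbp, hab, hQ⟩ := hP.exit (R := ({r₁, r₂} : Set (Site 2))ᶜ) hsR htR
  have hbR' : b ∈ ({r₁, r₂} : Set (Site 2)) := not_not.1 hbR
  have hbt : b = t := honly b hbp hbR'
  have hpre : ({r₁, r₂} : Set (Site 2))ᶜ ∩ {v | v ∈ p.support} ⊆ {v | v ∈ p.support ∧ v ∈ X.B𝔅} := fun v hv =>
    ⟨hv.2, by rcases hpA v hv.2 with h | h; exacts [h, absurd h hv.1]⟩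
  have hQ' : PathIn triGraph {v | v ∈ p.support ∧ v ∈ X.B𝔅} s a' :=
    X.pathIn_of_pathIn_cG hr₁F hr₂F (hQ.mono hpre) fun v hv => hv.2.2
  have ha'F : a' ∉ X.FF𝔉 := (hpre hQ.right_mem).2.2
  have hbF : b ∈ X.FF𝔉 := hRF b hbR'
  -- the edge `a' → b` is an adjacency of `a'` to an actual fence site of the structure of `b`
  have hAF : X.AdjF r₁ r₂ a' b := by
    rcases hab.2 with h | h | h
    · exact absurd hbF h.2.1
    · exact h.2
    · exact absurd hbF h.1
  rcases hAF with ⟨hb1, f, hf, haf⟩ | ⟨hb2, f, hf, haf⟩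
  · have htr : t = r₁ := hbt.symm.trans hb1
    obtain ⟨f₀, hf₀, rfl⟩ := hf
    rcases hf₀ with ⟨u, c, z, hu, hfF⟩ | ⟨u, d, z, hu, hfF⟩
    · let S' : Set (Site 2) := {v | v ∈ p.support ∧ v ∈ X.B𝔅} ∪ X.φ₁ '' (X.D₁.fence hu).F
      refine ⟨ExitRef.below₁ u c z hu, S', iff_of_true rfl htr, ?_, Set.mem_image_of_mem _ (X.D₁.fence hu).m'_mem, subset_rfl⟩
      have h1 : PathIn triGraph S' s (X.φ₁ f₀) :=
        (hQ'.mono (Set.subset_union_left : _ ⊆ S')).tail haf (Or.inr (Set.mem_image_of_mem _ hfF))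
      exact h1.trans ((pathIn_map_iso X.φ₁ ((X.D₁.fence hu).pathIn_to_m' hfF)).mono (Set.subset_union_right : _ ⊆ S'))
    · let S' : Set (Site 2) := {v | v ∈ p.support ∧ v ∈ X.B𝔅} ∪ X.φ₁ '' (X.D₁.fenceUp hu).F
      refine ⟨ExitRef.up₁ u d z hu, S', iff_of_true rfl htr, ?_, Set.mem_image_of_mem _ (X.D₁.fenceUp hu).path.right_mem, subset_rfl⟩
      have h1 : PathIn triGraph S' s (X.φ₁ f₀) :=
        (hQ'.mono (Set.subset_union_left : _ ⊆ S')).tail haf (Or.inr (Set.mem_image_of_mem _ hfF))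
      exact h1.trans ((pathIn_map_iso X.φ₁ ((((X.D₁.fenceUp hu).tight _ hfF).symm.trans (X.D₁.fenceUp hu).path))).mono (Set.subset_union_right : _ ⊆ S'))
  · have htr : t = r₂ := hbt.symm.trans hb2
    have hiff : ∀ q : Fin 2, q = 1 → (q = 0 ↔ t = r₁) := by
      rintro q rfl
      exact iff_of_false (by decide) fun e => hne (e.symm.trans htr)
    obtain ⟨f₀, hf₀, rfl⟩ := hf
    rcases hf₀ with ⟨u, c, z, hu, hfF⟩ | ⟨u, d, z, hu, hfF⟩
    · let S' : Set (Site 2) := {v | v ∈ p.support ∧ v ∈ X.B𝔅} ∪ X.φ₂ '' (X.D₂.fence hu).F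
      refine ⟨ExitRef.below₂ u c z hu, S', hiff _ rfl, ?_, Set.mem_image_of_mem _ (X.D₂.fence hu).m'_mem, subset_rfl⟩
      have h1 : PathIn triGraph S' s (X.φ₂ f₀) :=
        (hQ'.mono (Set.subset_union_left : _ ⊆ S')).tail haf (Or.inr (Set.mem_image_of_mem _ hfF))
      exact h1.trans ((pathIn_map_iso X.φ₂ ((X.D₂.fence hu).pathIn_to_m' hfF)).mono (Set.subset_union_right : _ ⊆ S'))
    · let S' : Set (Site 2) := {v | v ∈ p.support ∧ v ∈ X.B𝔅} ∪ X.φ₂ '' (X.D₂.fenceUp hu).F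
      refine ⟨ExitRef.up₂ u d z hu, S', hiff _ rfl, ?_, Set.mem_image_of_mem _ (X.D₂.fenceUp hu).path.right_mem, subset_rfl⟩
      have h1 : PathIn triGraph S' s (X.φ₂ f₀) :=
        (hQ'.mono (Set.subset_union_left : _ ⊆ S')).tail haf (Or.inr (Set.mem_image_of_mem _ hfF))
      exact h1.trans ((pathIn_map_iso X.φ₂ ((((X.D₂.fenceUp hu).tight _ hfF).symm.trans (X.D₂.fenceUp hu).path))).mono (Set.subset_union_right : _ ⊆ S'))

/-- **Two vertex-disjoint clean routes exiting on different sides.** Under the avoidance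
hypotheses, the two starts are joined to the fence sites of two fences of DIFFERENT structures by
vertex-disjoint `𝕋`-paths, each through non-fence admissible sites (arms and terms of both
structures) and the connection of its own fence only. [cite: Nolin2008, §4.4 Lemma 15 (proof) (arXiv 0711.4948: Lemma 14, last paragraph)] [cite: Diestel2017, Thm. 3.3.1 and §1.7] -/
theorem exists_two_clean_routes
    (hav₁ : (∃ (i : Fin 2) (S : Set (Site 2)) (t : Site 2), t ∈ X.D₁.FFB ∧ PathIn triGraph S (X.D₁.b i) t ∧ S ⊆ X.D₁.AsetB ∧
      ∀ x ∈ S, X.φ₁ x ∉ X.FF𝔉₂))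
    (hav₂ : (∃ (i : Fin 2) (S : Set (Site 2)) (t : Site 2), t ∈ X.D₂.FFB ∧ PathIn triGraph S (X.D₂.b i) t ∧ S ⊆ X.D₂.AsetB ∧
      ∀ x ∈ S, X.φ₂ x ∉ X.FF𝔉₁)) :
    ∃ (e₀ e₁ : X.ExitRef) (S₀ S₁ : Set (Site 2)), e₀.side ≠ e₁.side ∧
      PathIn triGraph S₀ (X.φ₁ (X.D₁.b 0)) e₀.m𝔄 ∧ PathIn triGraph S₁ (X.φ₁ (X.D₁.b 1)) e₁.m𝔄 ∧
      e₀.m𝔄 ∈ e₀.F𝔄 ∧ e₁.m𝔄 ∈ e₁.F𝔄 ∧ S₀ ⊆ X.B𝔅 ∪ e₀.F𝔄 ∧ S₁ ⊆ X.B𝔅 ∪ e₁.F𝔄 ∧ Disjoint S₀ S₁ := by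
  classical
  -- representatives: the fence sites of the minimal terms from below
  obtain ⟨c₁, z₁, hu₁, -⟩ := X.D₁.uMin_spec
  obtain ⟨c₂, z₂, hu₂, -⟩ := X.D₂.uMin_spec
  have hr₁ : X.φ₁ (X.D₁.fence hu₁).m' ∈ X.FF𝔉₁ := ⟨_, Or.inl ⟨_, c₁, z₁, hu₁, (X.D₁.fence hu₁).m'_mem⟩, rfl⟩
  have hr₂ : X.φ₂ (X.D₂.fence hu₂).m' ∈ X.FF𝔉₂ := ⟨_, Or.inl ⟨_, c₂, z₂, hu₂, (X.D₂.fence hu₂).m'_mem⟩, rfl⟩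
  generalize hgr₁ : X.φ₁ (X.D₁.fence hu₁).m' = r₁ at hr₁
  generalize hgr₂ : X.φ₂ (X.D₂.fence hu₂).m' = r₂ at hr₂
  have hne : r₁ ≠ r₂ := fun e => X.FF_disjoint hr₁ (e ▸ hr₂)
  have hcut := X.hcut_cG hr₁ hr₂ hav₁ hav₂
  have hone : ∃ (s t : Site 2) (q : (X.cG r₁ r₂).Walk s t), s ∈ X.Src ∧ t ∈ ({r₁, r₂} : Set (Site 2)) ∧
      ∀ y ∈ q.support, y ∈ X.cA r₁ r₂ := by
    obtain ⟨s, t, q, hs, ht, hA, -⟩ := hcut (X.φ₁ (X.D₁.b 0)) (Or.inl (X.start_mem_B𝔅 (X.start_mem₁ 0)))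
    exact ⟨s, t, q, hs, ht, hA⟩
  obtain ⟨s₁, t₁, s₂, t₂, p₁, p₂, hs₁, ht₁, hs₂, ht₂, -, -, hA₁, hA₂, hdisj⟩ :=
    exists_two_disjoint_paths (G := X.cG r₁ r₂) hone hcut
  have hs : s₁ ≠ s₂ := fun h => hdisj s₁ p₁.start_mem_support (by rw [h]; exact p₂.start_mem_support)
  have ht : t₁ ≠ t₂ := fun h => hdisj _ p₁.end_mem_support (by rw [h]; exact p₂.end_mem_support)
  have two : ∀ y ∈ ({r₁, r₂} : Set (Site 2)), y = t₁ ∨ y = t₂ := by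
    intro y hy
    simp only [Set.mem_insert_iff, Set.mem_singleton_iff] at hy ht₁ ht₂
    rcases ht₁ with rfl | rfl <;> rcases ht₂ with rfl | rfl
    · exact absurd rfl ht
    · exact hy
    · exact hy.symm
    · exact absurd rfl ht
  have honly₁ : ∀ y ∈ p₁.support, y ∈ ({r₁, r₂} : Set (Site 2)) → y = t₁ := fun y hy hyR =>
    (two y hyR).elim id fun h => absurd (h ▸ p₂.end_mem_support) (hdisj y hy)
  have honly₂ : ∀ y ∈ p₂.support, y ∈ ({r₁, r₂} : Set (Site 2)) → y = t₂ := fun y hy hyR =>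
    (two y hyR).elim (fun h => absurd hy (hdisj y (h ▸ p₁.end_mem_support))) id
  obtain ⟨e₁, S₁, hside₁, hP₁, hm₁, hS₁⟩ := X.finish hr₁ hr₂ p₁ (X.start_mem_B𝔅 hs₁) ht₁ hA₁ honly₁
  obtain ⟨e₂, S₂, hside₂, hP₂, hm₂, hS₂⟩ := X.finish hr₁ hr₂ p₂ (X.start_mem_B𝔅 hs₂) ht₂ hA₂ honly₂
  have hs01 : ∀ f : X.ExitRef, f.side = 0 ∨ f.side = 1 := fun f => by
    rcases f with _ | _ | _ | _ <;> simp [ExitRef.side]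
  have hside : e₁.side ≠ e₂.side := by
    intro h
    simp only [Set.mem_insert_iff, Set.mem_singleton_iff] at ht₁ ht₂
    rcases hs01 e₁ with h0 | h0
    · exact ht ((hside₁.1 h0).trans (hside₂.1 (h ▸ h0)).symm)
    · have h1 : e₁.side ≠ 0 := by rw [h0]; decide
      have h2 : e₂.side ≠ 0 := by rw [← h, h0]; decide
      have ht₁' : t₁ = r₂ := ht₁.resolve_left fun e => h1 (hside₁.2 e)
      have ht₂' : t₂ = r₂ := ht₂.resolve_left fun e => h2 (hside₂.2 e)
      exact ht (ht₁'.trans ht₂'.symm)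
  have hdisjS : Disjoint S₁ S₂ := by
    rw [Set.disjoint_left]
    intro y hy₁ hy₂
    rcases hS₁ hy₁ with h₁ | h₁ <;> rcases hS₂ hy₂ with h₂ | h₂
    · exact hdisj y h₁.1 h₂.1
    · exact h₁.2.2 (e₂.F𝔄_subset_FF h₂)
    · exact h₂.2.2 (e₁.F𝔄_subset_FF h₁)
    · exact Set.disjoint_left.1 (ExitRef.F𝔄_disjoint hside) h₁ h₂
  have hS₁' : S₁ ⊆ X.B𝔅 ∪ e₁.F𝔄 := hS₁.trans (Set.union_subset_union_left _ fun v hv => hv.2)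
  have hS₂' : S₂ ⊆ X.B𝔅 ∪ e₂.F𝔄 := hS₂.trans (Set.union_subset_union_left _ fun v hv => hv.2)
  simp only [Src, Set.mem_insert_iff, Set.mem_singleton_iff] at hs₁ hs₂
  rcases hs₁ with rfl | rfl <;> rcases hs₂ with rfl | rfl
  · exact absurd rfl hs
  · exact ⟨e₁, e₂, S₁, S₂, hside, hP₁, hP₂, hm₁, hm₂, hS₁', hS₂', hdisjS⟩
  · exact ⟨e₂, e₁, S₂, S₁, hside.symm, hP₂, hP₁, hm₂, hm₁, hS₂', hS₁', hdisjS.symm⟩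
  · exact absurd rfl hs

/-- **Non-fence sites of a clean route lie in `Λ_{2M}`** (they are arm or term sites of one of the
structures, carried by a graph automorphism preserving... ) — recorded in the form used downstream:
a non-fence admissible site is the image of an arm or term site of `D₁` or of `D₂`. [folklore] -/
theorem mem_B𝔅 (X : IntCrossData m N k₀ K T₁ T₁' T₂ T₂' R₀ χ₁ χ₂) {v : Site 2} (hv : v ∈ X.B𝔅) :
    (∃ x, (x ∈ X.D₁.armSet ∨ (∃ (u : ℕ) (c : Finset (Site 2)) (z : Site 2) (_ : (intDom m).lowestSeq χ₁ u = some (c, z)), x ∈ c) ∨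
        ∃ (u : ℕ) (d : Finset (Site 2)) (z : Site 2) (_ : (intDom m).flip.lowestSeq χ₁ u = some (d, z)), x ∈ d) ∧ X.φ₁ x = v) ∨
      ∃ x, (x ∈ X.D₂.armSet ∨ (∃ (u : ℕ) (c : Finset (Site 2)) (z : Site 2) (_ : (intDom m).lowestSeq χ₂ u = some (c, z)), x ∈ c) ∨
        ∃ (u : ℕ) (d : Finset (Site 2)) (z : Site 2) (_ : (intDom m).flip.lowestSeq χ₂ u = some (d, z)), x ∈ d) ∧ X.φ₂ x = v := by
  obtain ⟨hvA, hvF⟩ := hv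
  rcases hvA with ⟨x, hx, rfl⟩ | ⟨x, hx, rfl⟩
  · left
    refine ⟨x, ?_, rfl⟩
    rcases hx with (hx | ⟨u, c, z, hu, hx | hx⟩) | ⟨u, d, z, hu, hx | hx⟩
    · exact Or.inl hx
    · exact Or.inr (Or.inl ⟨u, c, z, hu, hx⟩)
    · exact absurd (Or.inl ⟨x, Or.inl ⟨u, c, z, hu, hx⟩, rfl⟩ : X.φ₁ x ∈ X.FF𝔉) hvF
    · exact Or.inr (Or.inr ⟨u, d, z, hu, hx⟩)
    · exact absurd (Or.inl ⟨x, Or.inr ⟨u, d, z, hu, hx⟩, rfl⟩ : X.φ₁ x ∈ X.FF𝔉) hvF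
  · right
    refine ⟨x, ?_, rfl⟩
    rcases hx with (hx | ⟨u, c, z, hu, hx | hx⟩) | ⟨u, d, z, hu, hx | hx⟩
    · exact Or.inl hx
    · exact Or.inr (Or.inl ⟨u, c, z, hu, hx⟩)
    · exact absurd (Or.inr ⟨x, Or.inl ⟨u, c, z, hu, hx⟩, rfl⟩ : X.φ₂ x ∈ X.FF𝔉) hvF
    · exact Or.inr (Or.inr ⟨u, d, z, hu, hx⟩)
    · exact absurd (Or.inr ⟨x, Or.inr ⟨u, d, z, hu, hx⟩, rfl⟩ : X.φ₂ x ∈ X.FF𝔉) hvF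

end IntCrossData

end Literature.Probability.Percolation
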